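import Mathlib

/-!
# A kernel presentation `0 → M → S^a → S^b` localises — sub-goal (L1a) of stub (R)
# `stub_raynaudConnectedness`

Route `SkinnerWilesDefectOne`, crux `ReducibleOrdinaryProModular` (stmt-Langlands-12919), line
`fine-selmer-codimension-two`, registered stub (R) `stub_raynaudConnectedness` (Grothendieck's
connectedness theorem, SGA2 XIII 2.1), sub-goal (L1a): localisation of modules is exact and commutes
with finite products, so an exact sequence `0 → M → S^a → S^b` of `S`-modules localises at a
submonoid `T ⊆ S` to an exact sequence `0 → T⁻¹M → R^a → R^b` of `R = T⁻¹S`-modules.  Pure Mathlib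
module theory, sorry-free:

* `Theorems.exists_localized_kernelPresentation` — the statement for an arbitrary finite index type
  `ι` in place of `Fin a` (and `κ` in place of `Fin b`), with the localised maps given explicitly as
  `IsLocalizedModule.map` of the original ones along the componentwise localisation maps
  `(ι → S) → (ι → R)` (Mathlib `IsLocalizedModule.pi`), made `R`-linear by
  `LinearMap.extendScalarsOfIsLocalization`; injectivity is `IsLocalizedModule.map_injective` and
  exactness is `IsLocalizedModule.map_exact`;
* `FineSelmerCodimensionTwo.stub_raynaudConnectedness_auxLocalizeKernelPresentation` (registered
  sub-goal (L1a)) — the REGISTERED statement, binders verbatim.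

References: A. Grothendieck, SGA 2, Exp. XIII Thm. 2.1 [Grothendieck1968SGA2]; N. Bourbaki,
*Commutative Algebra*, II §2.4 Thm. 1 (flatness of localisation) [folklore].
-/

set_option linter.dupNamespace false -- project-wide option (lakefile weak.linter.dupNamespace); `Summit.Langlands.Langlands` is the mandated namespace
set_option autoImplicit false

namespace Summit.Langlands.Langlands.Theorems

/-- **Localising a kernel presentation.**  Let `R` be the localisation of `S` at `T`, `g : M → M'` a
`T`-localisation of `S`-modules, and `0 → M —Φ→ S^ι —Ψ→ S^κ` exact (`Φ` injective,
`range Φ = ker Ψ`) with `ι`, `κ` finite.  Then the `T`-localised maps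
`Φ' : M' → R^ι`, `Ψ' : R^ι → R^κ` (Mathlib `IsLocalizedModule.map` along the componentwise maps
`S^ι → R^ι`, `S^κ → R^κ`, which are `T`-localisations by `IsLocalizedModule.pi`) are `R`-linear,
`Φ'` is injective and `range Φ' = ker Ψ'` — localisation is exact. [folklore] -/
theorem exists_localized_kernelPresentation {S : Type*} [CommRing S] (T : Submonoid S)
    (R : Type*) [CommRing R] [Algebra S R] [IsLocalization T R]
    {M : Type*} [AddCommGroup M] [Module S M]
    {M' : Type*} [AddCommGroup M'] [Module S M'] [Module R M'] [IsScalarTower S R M']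
    (g : M →ₗ[S] M') [IsLocalizedModule T g] {ι κ : Type*} [Finite ι] [Finite κ]
    (Φ : M →ₗ[S] (ι → S)) (Ψ : (ι → S) →ₗ[S] (κ → S))
    (hΦ : Function.Injective Φ) (hex : LinearMap.range Φ = LinearMap.ker Ψ) :
    ∃ (Φ' : M' →ₗ[R] (ι → R)) (Ψ' : (ι → R) →ₗ[R] (κ → R)),
      Φ'.restrictScalars S ∘ₗ g =
          (LinearMap.pi fun i => Algebra.linearMap S R ∘ₗ LinearMap.proj i) ∘ₗ Φ ∧
      Ψ'.restrictScalars S ∘ₗ (LinearMap.pi fun i => Algebra.linearMap S R ∘ₗ LinearMap.proj i) =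
          (LinearMap.pi fun i => Algebra.linearMap S R ∘ₗ LinearMap.proj i) ∘ₗ Ψ ∧
      Function.Injective Φ' ∧ LinearMap.range Φ' = LinearMap.ker Ψ' := by
  -- the componentwise localisation maps `S^ι → R^ι`, `S^κ → R^κ` are `T`-localisations
  let πι : (ι → S) →ₗ[S] (ι → R) := LinearMap.pi fun i => Algebra.linearMap S R ∘ₗ LinearMap.proj i
  let πκ : (κ → S) →ₗ[S] (κ → R) := LinearMap.pi fun i => Algebra.linearMap S R ∘ₗ LinearMap.proj i
  haveI hι : IsLocalizedModule T πι := IsLocalizedModule.pi T fun _ => Algebra.linearMap S R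
  haveI hκ : IsLocalizedModule T πκ := IsLocalizedModule.pi T fun _ => Algebra.linearMap S R
  -- the localised maps, `S`-linear, then `R`-linear
  let Φ₀ : M' →ₗ[S] (ι → R) := IsLocalizedModule.map T g πι Φ
  let Ψ₀ : (ι → R) →ₗ[S] (κ → R) := IsLocalizedModule.map T πι πκ Ψ
  refine ⟨Φ₀.extendScalarsOfIsLocalization T R, Ψ₀.extendScalarsOfIsLocalization T R,
    IsLocalizedModule.map_comp T g πι Φ, IsLocalizedModule.map_comp T πι πκ Ψ,
    IsLocalizedModule.map_injective T g πι Φ hΦ, ?_⟩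
  have hex' : Function.Exact Φ Ψ := LinearMap.exact_iff.mpr hex.symm
  -- extending scalars does not change the underlying functions
  have key : Function.Exact (Φ₀.extendScalarsOfIsLocalization T R)
      (Ψ₀.extendScalarsOfIsLocalization T R) :=
    IsLocalizedModule.map_exact T g πι πκ Φ Ψ hex'
  exact (LinearMap.exact_iff.mp key).symm

end Summit.Langlands.Langlands.Theorems

namespace Summit.Langlands.Langlands.Cruxes.ReducibleOrdinaryProModular.FineSelmerCodimensionTwo

/-- **Registered sub-goal (L1a) `stub_raynaudConnectedness_auxLocalizeKernelPresentation` of stub (R)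
`stub_raynaudConnectedness`**: a kernel presentation `0 → M → S^a → S^b` of `S`-modules localises at
`T` to a kernel presentation `0 → M' → R^a → R^b` of `R = T⁻¹S`-modules (`M'` a `T`-localisation of
`M`) — `Theorems.exists_localized_kernelPresentation` at `ι = Fin a`, `κ = Fin b`, universe `0`.
[folklore] -/
theorem stub_raynaudConnectedness_auxLocalizeKernelPresentation : ∀ (S : Type) [CommRing S] (T : Submonoid S) (R : Type) [CommRing R] [Algebra S R] [IsLocalization T R] (M : Type) [AddCommGroup M] [Module S M] (M' : Type) [AddCommGroup M'] [Module S M'] [Module R M'] [IsScalarTower S R M'] (g : M →ₗ[S] M') [IsLocalizedModule T g] (a b : ℕ) (Φ : M →ₗ[S] (Fin a → S)) (Ψ : (Fin a → S) →ₗ[S] (Fin b → S)), Function.Injective Φ → LinearMap.range Φ = LinearMap.ker Ψ → ∃ (Φ' : M' →ₗ[R] (Fin a → R)) (Ψ' : (Fin a → R) →ₗ[R] (Fin b → R)), Function.Injective Φ' ∧ LinearMap.range Φ' = LinearMap.ker Ψ' := by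
  intro S _ T R _ _ _ M _ _ M' _ _ _ _ g _ a b Φ Ψ hΦ hex
  obtain ⟨Φ', Ψ', -, -, hΦ', hex'⟩ :=
    Summit.Langlands.Langlands.Theorems.exists_localized_kernelPresentation T R g Φ Ψ hΦ hex
  exact ⟨Φ', Ψ', hΦ', hex'⟩

end Summit.Langlands.Langlands.Cruxes.ReducibleOrdinaryProModular.FineSelmerCodimensionTwo
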